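import Summits.AtomisticToContinuum.FouriersLaw.Theses.EmbeddedDrudeMourre

/-!
# `FGRGap`, line fold-jet-rigidity, stub `stub_oddEssentialGap` — part A: weakly-null sequences kill
# bounded compactly supported kernels

Helper file for the crux `Summit.AtomisticToContinuum.FouriersLaw.Theses.EmbeddedDrudeMourre.FGRGap`
(item `stmt-AtomisticToContinuum-12595`), registered stub `stub_oddEssentialGap` (the odd essential gap of
ALS's linearised phonon-Boltzmann form: `liminf q(f_n) ≥ v₀ > 0` along weakly-null odd unit sequences of
`L²(cell)`). The proof of the stub truncates the form to finitely many general-position rectangles of the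
`(k₁,k₃)`-chart and expands the square; the six CROSS TERMS become, after a change of variables, bilinear
forms `∫∫ K(x,y) g(x) g(y)` with a bounded kernel `K` supported in a bounded square. This file proves the
functional-analytic fact used to dispose of them:

* `periodic bookkeeping`: for a `2π`-periodic `g` the square integral over the big window
  `(-(π + 2πN), π + 2πN]` is `(2N+1)·‖g‖²_{cell}`, and a pairing `∫ ψ g` against a test function supported
  in that window is a cell pairing against the FOLDED test function `∑_{|j| ≤ N} ψ(· + 2πj)`;
* (in the sequel file `…EssGapB`) `tendsto_kernel_form_of_weaklyNull` (the main lemma): if `g_n` are `2π`-periodic, measurable, with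
  `‖g_n‖²_{cell} ≤ 1`, and WEAKLY NULL on the cell (`∫_{cell} φ g_n → 0` for every measurable `φ` with
  `‖φ‖²_{cell} < ∞`), then `∫∫ K(x,y) g_n(x) g_n(y) dx dy → 0` for every bounded a.e.-strongly-measurable
  kernel `K` vanishing outside the big square: the functions `G_n(x) = ∫ K(x,y) g_n(y) dy` tend to `0`
  pointwise (weak nullness, tested against the folded sections of `K`), are uniformly bounded, vanish
  outside the window, so `‖G_n‖₂ → 0` by dominated convergence and `|∫ g_n G_n| ≤ ‖g_n‖ ‖G_n‖ → 0`.

All statements are folklore measure theory; no named facts.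
-/

noncomputable section

open MeasureTheory Set Real Filter Topology
open scoped ENNReal
open Literature.MathematicalPhysics.KineticTheory.PhononBoltzmann

namespace Summit.AtomisticToContinuum.FouriersLaw.Theorems.FGRGap.FoldJetRigidity.EssGap

/-! ## 1. Periodic bookkeeping on the window `(-(π + 2πN), π + 2πN]` -/

/-- The translate of the cell by `2πj` is `(-π + 2πj, π + 2πj]`; membership in the big window
`(-π - 2πN, π + 2πN]` means membership in one of the translates with `|j| ≤ N`. [folklore] -/
theorem mem_window_iff (N : ℕ) (x : ℝ) :
    x ∈ Ioc (-π - N * (2 * π)) (π + N * (2 * π)) ↔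
      ∃ j : ℤ, -(N : ℤ) ≤ j ∧ j ≤ N ∧ x ∈ Ioc (-π + j * (2 * π)) (π + j * (2 * π)) := by
  constructor
  · intro hx
    -- the index of the translate containing `x`
    refine ⟨⌈(x - π) / (2 * π)⌉, ?_, ?_, ?_, ?_⟩
    · have h1 : (-(N : ℝ) : ℝ) - 1 < (x - π) / (2 * π) := by
        rw [lt_div_iff₀ (by positivity)]
        nlinarith [hx.1, Real.pi_pos]
      have h2 : (-(N : ℤ) : ℤ) - 1 < ⌈(x - π) / (2 * π)⌉ := by
        rw [Int.lt_ceil]; push_cast; exact h1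
      omega
    · have h1 : (x - π) / (2 * π) ≤ N := by
        rw [div_le_iff₀ (by positivity)]
        linarith [hx.2]
      exact Int.ceil_le.mpr (by exact_mod_cast h1)
    · have h := Int.ceil_lt_add_one ((x - π) / (2 * π))
      have h' : (x - π) / (2 * π) * (2 * π) = x - π := by field_simp
      nlinarith [Real.pi_pos, h, h']
    · have h := Int.le_ceil ((x - π) / (2 * π))
      have h' : (x - π) / (2 * π) * (2 * π) = x - π := by field_simp
      nlinarith [Real.pi_pos, h, h']
  · rintro ⟨j, hj1, hj2, hx1, hx2⟩
    have hj1' : (-(N : ℝ)) ≤ (j : ℝ) := by exact_mod_cast hj1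
    have hj2' : (j : ℝ) ≤ N := by exact_mod_cast hj2
    constructor <;> nlinarith [Real.pi_pos]

/-- Distinct translates of the cell are disjoint. [folklore] -/
theorem disjoint_cell_translates {j j' : ℤ} (h : j ≠ j') :
    Disjoint (Ioc (-π + j * (2 * π)) (π + j * (2 * π))) (Ioc (-π + j' * (2 * π)) (π + j' * (2 * π))) := by
  rw [Set.disjoint_left]
  intro x hx hx'
  rcases lt_or_gt_of_ne h with hlt | hlt
  · have : (j : ℝ) + 1 ≤ j' := by exact_mod_cast hlt
    nlinarith [hx.2, hx'.1, Real.pi_pos]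
  · have : (j' : ℝ) + 1 ≤ j := by exact_mod_cast hlt
    nlinarith [hx'.2, hx.1, Real.pi_pos]

/-- The big window is the finite disjoint union of the translates `(-π + 2πj, π + 2πj]`, `|j| ≤ N`.
[folklore] -/
theorem window_eq_biUnion (N : ℕ) :
    Ioc (-π - N * (2 * π)) (π + N * (2 * π)) =
      ⋃ j ∈ Finset.Icc (-(N : ℤ)) N, Ioc (-π + j * (2 * π)) (π + j * (2 * π)) := by
  ext x
  rw [mem_window_iff]
  simp only [mem_iUnion, Finset.mem_Icc, exists_prop]
  constructor
  · rintro ⟨j, h1, h2, h3⟩; exact ⟨j, ⟨h1, h2⟩, h3⟩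
  · rintro ⟨j, ⟨h1, h2⟩, h3⟩; exact ⟨j, h1, h2, h3⟩

/-- A `2π`-periodic function is `2πj`-periodic for every integer `j`. [folklore] -/
theorem periodic_int_mul {g : ℝ → ℝ} (hg : Function.Periodic g (2 * π)) (j : ℤ) (x : ℝ) :
    g (x + j * (2 * π)) = g x :=
  hg.int_mul j x

/-- Shifting a set integral over a translate of the cell back to the cell. [folklore] -/
theorem setIntegral_cell_translate (F : ℝ → ℝ) (j : ℤ) :
    ∫ x in Ioc (-π + j * (2 * π)) (π + j * (2 * π)), F x =
      ∫ x in Ioc (-π) π, F (x + j * (2 * π)) := by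
  have h := (MeasureTheory.integral_indicator (measurableSet_Ioc (a := -π + j * (2 * π))
    (b := π + j * (2 * π))) (f := F) (μ := volume)).symm
  rw [h, ← integral_add_right_eq_self _ (j * (2 * π))]
  rw [← MeasureTheory.integral_indicator measurableSet_Ioc]
  congr 1
  ext x
  simp only [Set.indicator]
  have : (x + j * (2 * π) ∈ Ioc (-π + j * (2 * π)) (π + j * (2 * π))) ↔ x ∈ Ioc (-π) π := by
    constructor
    · intro hx; exact ⟨by linarith [hx.1], by linarith [hx.2]⟩
    · intro hx; exact ⟨by linarith [hx.1], by linarith [hx.2]⟩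
  by_cases hx : x ∈ Ioc (-π) π
  · rw [if_pos (this.mpr hx), if_pos hx]
  · rw [if_neg (fun h' => hx (this.mp h')), if_neg hx]

/-- Shifting a set lower integral over a translate of the cell back to the cell. [folklore] -/
theorem setLIntegral_cell_translate (G : ℝ → ℝ≥0∞) (j : ℤ) :
    ∫⁻ x in Ioc (-π + j * (2 * π)) (π + j * (2 * π)), G x =
      ∫⁻ x in Ioc (-π) π, G (x + j * (2 * π)) := by
  rw [← lintegral_indicator measurableSet_Ioc, ← lintegral_add_right_eq_self _ (j * (2 * π)),
    ← lintegral_indicator measurableSet_Ioc]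
  congr 1
  ext x
  simp only [Set.indicator]
  have : (x + j * (2 * π) ∈ Ioc (-π + j * (2 * π)) (π + j * (2 * π))) ↔ x ∈ Ioc (-π) π := by
    constructor
    · intro hx; exact ⟨by linarith [hx.1], by linarith [hx.2]⟩
    · intro hx; exact ⟨by linarith [hx.1], by linarith [hx.2]⟩
  by_cases hx : x ∈ Ioc (-π) π
  · rw [if_pos (this.mpr hx), if_pos hx]
  · rw [if_neg (fun h' => hx (this.mp h')), if_neg hx]

/-- **Square integral of a periodic function over the window**:
`∫_{window} g² ≤ (2N+1) ‖g‖²_{cell}`. [folklore] -/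
theorem lintegral_sq_window_le {g : ℝ → ℝ} (hg : Function.Periodic g (2 * π)) (N : ℕ) :
    ∫⁻ x in Ioc (-π - N * (2 * π)) (π + N * (2 * π)), ENNReal.ofReal (g x ^ 2) ≤
      (2 * N + 1 : ℝ≥0∞) * cellNormSq g := by
  rw [window_eq_biUnion]
  have hd : Set.PairwiseDisjoint (↑(Finset.Icc (-(N : ℤ)) N) : Set ℤ)
      (fun j : ℤ => Ioc (-π + j * (2 * π)) (π + j * (2 * π))) :=
    fun j _ j' _ hjj' => disjoint_cell_translates hjj'
  rw [lintegral_biUnion_finset hd (fun j _ => measurableSet_Ioc)]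
  apply le_of_eq
  calc ∑ j ∈ Finset.Icc (-(N : ℤ)) N,
          ∫⁻ x in Ioc (-π + j * (2 * π)) (π + j * (2 * π)), ENNReal.ofReal (g x ^ 2)
      = ∑ _j ∈ Finset.Icc (-(N : ℤ)) N, cellNormSq g := by
        apply Finset.sum_congr rfl
        intro j _
        rw [setLIntegral_cell_translate]
        unfold cellNormSq
        congr 1; ext x; rw [periodic_int_mul hg]
    _ = (2 * N + 1 : ℝ≥0∞) * cellNormSq g := by
        rw [Finset.sum_const, Int.card_Icc, nsmul_eq_mul]
        congr 1
        have : ((N : ℤ) + 1 - -(N : ℤ)).toNat = 2 * N + 1 := by omega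
        rw [this]; push_cast; ring


/-! ## 2. Local integrability of periodic `L²(cell)` functions -/

/-- A `2π`-periodic measurable `g` with `‖g‖²_{cell} < ∞` is square-integrable on every window.
[folklore] -/
theorem integrableOn_sq_window {g : ℝ → ℝ} (hg : Function.Periodic g (2 * π)) (hgm : Measurable g)
    (hg2 : cellNormSq g < ∞) (N : ℕ) :
    IntegrableOn (fun x => g x ^ 2) (Ioc (-π - N * (2 * π)) (π + N * (2 * π))) := by
  refine ⟨(hgm.pow_const 2).aestronglyMeasurable, ?_⟩
  rw [hasFiniteIntegral_iff_enorm]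
  have h := lintegral_sq_window_le hg N
  have e : ∀ x, ‖g x ^ 2‖ₑ = ENNReal.ofReal (g x ^ 2) := fun x =>
    Real.enorm_eq_ofReal (sq_nonneg _)
  simp_rw [e]
  refine lt_of_le_of_lt h (ENNReal.mul_lt_top ?_ hg2)
  exact ENNReal.add_lt_top.2 ⟨ENNReal.mul_lt_top (by simp) (by simp), ENNReal.one_lt_top⟩

/-- … hence in `L²` of every window … [folklore] -/
theorem memLp_two_window {g : ℝ → ℝ} (hg : Function.Periodic g (2 * π)) (hgm : Measurable g)
    (hg2 : cellNormSq g < ∞) (N : ℕ) :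
    MemLp g 2 (volume.restrict (Ioc (-π - N * (2 * π)) (π + N * (2 * π)))) :=
  (memLp_two_iff_integrable_sq hgm.aestronglyMeasurable).2 (integrableOn_sq_window hg hgm hg2 N)

/-- … hence integrable on every window. [folklore] -/
theorem integrableOn_window {g : ℝ → ℝ} (hg : Function.Periodic g (2 * π)) (hgm : Measurable g)
    (hg2 : cellNormSq g < ∞) (N : ℕ) :
    IntegrableOn g (Ioc (-π - N * (2 * π)) (π + N * (2 * π))) := by
  have h := memLp_two_window hg hgm hg2 N
  haveI : IsFiniteMeasure (volume.restrict (Ioc (-π - (N : ℝ) * (2 * π)) (π + N * (2 * π)))) := by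
    infer_instance
  exact h.integrable one_le_two

/-- The real square integral over the window is at most `2N+1` for `‖g‖²_{cell} ≤ 1`. [folklore] -/
theorem integral_sq_window_le {g : ℝ → ℝ} (hg : Function.Periodic g (2 * π)) (hgm : Measurable g)
    (hg1 : cellNormSq g ≤ 1) (N : ℕ) :
    ∫ x in Ioc (-π - N * (2 * π)) (π + N * (2 * π)), g x ^ 2 ≤ 2 * N + 1 := by
  have hfin : cellNormSq g < ∞ := lt_of_le_of_lt hg1 ENNReal.one_lt_top
  rw [integral_eq_lintegral_of_nonneg_ae (Eventually.of_forall fun x => sq_nonneg (g x))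
    (hgm.pow_const 2).aestronglyMeasurable]
  have h := lintegral_sq_window_le hg N
  have h' : ∫⁻ x in Ioc (-π - N * (2 * π)) (π + N * (2 * π)), ENNReal.ofReal (g x ^ 2) ≤
      (2 * N + 1 : ℝ≥0∞) := le_trans h (by simpa using mul_le_mul_right hg1 (2 * N + 1 : ℝ≥0∞))
  have hne : (2 * (N : ℝ≥0∞) + 1) ≠ ⊤ :=
    (ENNReal.add_lt_top.2 ⟨ENNReal.mul_lt_top (by simp) (by simp), ENNReal.one_lt_top⟩).ne
  calc (∫⁻ x in Ioc (-π - N * (2 * π)) (π + N * (2 * π)), ENNReal.ofReal (g x ^ 2)).toReal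
      ≤ (2 * (N : ℝ≥0∞) + 1).toReal := ENNReal.toReal_mono hne h'
    _ = 2 * N + 1 := by
        rw [ENNReal.toReal_add (ENNReal.mul_lt_top (by simp) (by simp)).ne ENNReal.one_ne_top,
          ENNReal.toReal_mul]
        simp

/-! ## 3. Pairings against test functions supported in the window -/

/-- **Unfolding a pairing**: for `2π`-periodic `g ∈ L²(cell)` and a bounded measurable test function `ψ`
vanishing off the window, `∫ ψ g = ∫_{cell} ψ̃ g` with the FOLDED test function
`ψ̃ = ∑_{|j| ≤ N} ψ(· + 2πj)`. [folklore] -/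
theorem integral_mul_eq_cellPairing_fold {ψ g : ℝ → ℝ} (N : ℕ) {M : ℝ} (hψm : Measurable ψ)
    (hψb : ∀ x, |ψ x| ≤ M) (hψ0 : ∀ x, x ∉ Ioc (-π - N * (2 * π)) (π + N * (2 * π)) → ψ x = 0)
    (hg : Function.Periodic g (2 * π)) (hgm : Measurable g) (hg2 : cellNormSq g < ∞) :
    ∫ x, ψ x * g x = cellPairing (fun x => ∑ j ∈ Finset.Icc (-(N : ℤ)) N, ψ (x + j * (2 * π))) g := by
  -- integrability of `ψ g` on every translate of the cell
  have hint : ∀ j : ℤ, IntegrableOn (fun x => ψ x * g x) (Ioc (-π + j * (2 * π)) (π + j * (2 * π))) := by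
    intro j
    have hgj : IntegrableOn g (Ioc (-π + j * (2 * π)) (π + j * (2 * π))) := by
      -- the translate is contained in a window
      obtain ⟨N', hN'⟩ : ∃ N' : ℕ, |j| ≤ N' := ⟨j.natAbs, by simp⟩
      refine (integrableOn_window hg hgm hg2 N').mono_set ?_
      intro x hx
      have hj1 : -(N' : ℤ) ≤ j := by have := neg_abs_le j; omega
      have hj2 : j ≤ N' := (le_abs_self j).trans hN'
      have h1 : (-(N' : ℝ)) ≤ j := by exact_mod_cast hj1
      have h2 : (j : ℝ) ≤ N' := by exact_mod_cast hj2
      constructor <;> nlinarith [hx.1, hx.2, Real.pi_pos]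
    refine Integrable.bdd_mul (c := M) hgj hψm.aestronglyMeasurable (Eventually.of_forall fun x => ?_)
    rw [Real.norm_eq_abs]; exact hψb x
  have h1 : ∫ x, ψ x * g x = ∫ x in Ioc (-π - N * (2 * π)) (π + N * (2 * π)), ψ x * g x := by
    refine (setIntegral_eq_integral_of_forall_compl_eq_zero fun x hx => ?_).symm
    rw [hψ0 x hx, zero_mul]
  rw [h1, window_eq_biUnion, integral_biUnion_finset _ (fun j _ => measurableSet_Ioc)
    (fun j _ j' _ hjj' => disjoint_cell_translates hjj') (fun j _ => hint j)]
  unfold cellPairing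
  simp_rw [Finset.sum_mul]
  rw [integral_finsetSum]
  · apply Finset.sum_congr rfl
    intro j _
    rw [setIntegral_cell_translate]
    congr 1; ext x; rw [periodic_int_mul hg]
  · -- integrability of each shifted term on the cell
    intro j _
    have hmp : MeasurePreserving (fun x : ℝ => x + j * (2 * π)) volume volume :=
      measurePreserving_add_right volume _
    have hemb : MeasurableEmbedding (fun x : ℝ => x + j * (2 * π)) :=
      measurableEmbedding_addRight _
    have hpre : (fun x : ℝ => x + j * (2 * π)) ⁻¹' (Ioc (-π + j * (2 * π)) (π + j * (2 * π))) =
        Ioc (-π) π := by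
      ext x; constructor
      · intro hx; exact ⟨by linarith [hx.1], by linarith [hx.2]⟩
      · intro hx; exact ⟨by linarith [hx.1], by linarith [hx.2]⟩
    have h := (hmp.integrableOn_comp_preimage hemb).2 (hint j)
    rw [hpre] at h
    refine h.congr_fun (fun x _ => ?_) measurableSet_Ioc
    simp only [Function.comp]
    rw [periodic_int_mul hg]

end Summit.AtomisticToContinuum.FouriersLaw.Theorems.FGRGap.FoldJetRigidity.EssGap

namespace Summit.AtomisticToContinuum.FouriersLaw.Theorems.FGRGap.FoldJetRigidity

/-- REGISTERED HELPER STUB `stub_oddEssentialGap_partA` (landing vehicle of this file): unfolding a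
pairing against a bounded window-supported test function into a cell pairing against the folded test
function (`EssGap.integral_mul_eq_cellPairing_fold`). [folklore] -/
theorem stub_oddEssentialGap_partA :
    ∀ (N : ℕ) (M : ℝ) (ψ g : ℝ → ℝ), Measurable ψ → (∀ x, |ψ x| ≤ M) →
      (∀ x, x ∉ Set.Ioc (-π - N * (2 * π)) (π + N * (2 * π)) → ψ x = 0) →
      Function.Periodic g (2 * π) → Measurable g → cellNormSq g < ⊤ →
      ∫ x, ψ x * g x = cellPairing (fun x => ∑ j ∈ Finset.Icc (-(N : ℤ)) N, ψ (x + j * (2 * π))) g :=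
  fun N _M _ψ _g hψm hψb hψ0 hg hgm hg2 => EssGap.integral_mul_eq_cellPairing_fold N hψm hψb hψ0 hg hgm hg2

end Summit.AtomisticToContinuum.FouriersLaw.Theorems.FGRGap.FoldJetRigidity

end
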